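import Literature.NumberTheory.ModularForms.SymplecticGroupEllAdicPointsDense
import Literature.AlgebraicGeometry.ModuliOfAbelianVarieties.SiegelHeckeOrbitDensity
import HarnessLib

/-!
# `ℓ`-adic Hecke moves of polarisation type `δ`: the real symplectic matrices whose rational representation
# `M_N = diag(1,Δ)⁻¹ ᵗN diag(1,Δ)` (and `A_N = M_N⁻¹`) are `ℓ`-adic form a DENSE subgroup of `Sp_{2g}(ℝ)`

Layer `Literature/AlgebraicGeometry/ModuliOfAbelianVarieties`, namespace
`Literature.AlgebraicGeometry.ModuliOfAbelianVarieties.SiegelModuli`.  THEOREMS ONLY (no definition, no named fact, no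
instance, no notation, no `sorry`).  Sequel of ★ `SymplecticGroupEllAdicPointsDense` (`Sp_{2g}(ℤ[1/ℓ])` is dense in
`Sp_{2g}(ℝ)`, [PlatonovRapinchuk1994] Thm. 7.12 at the real place) TWISTED BY THE TYPE `δ`: for a polarisation type
`δ` (`Δ = diag(δ₁,…,δ_g)`), the period of the isogeny partner `N • Z` of `X_Z^δ` is read through Lange's rational
representation `M_N = diag(1,Δ)⁻¹ ᵗN diag(1,Δ)` (★ `ratRep`, [Lange2023AbelianVarietiesComplex] Rem. 3.1.14) and
`A_N = M_N⁻¹` (★ `toSpForm`, Lemma 7.1.7: `J_{N•Z} = A_N J_Z A_N⁻¹`).  For the isogeny to have `ℓ`-POWER degree one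
needs `M_N` and `A_N` to be `ℓ`-adic (`ℓᵏ M_N`, `ℓᵏ A_N` integral), which for non-principal `δ` is NOT the same as `N`
being `ℓ`-adic (the conjugation by `diag(1,Δ)` introduces denominators `δᵢ`).  We prove:

* for a level `N ≥ 1`, the `P ∈ Sp_{2g}(ℝ)` with `ℓᵏ(A_P − 1)` and `ℓᵏ(M_P − 1)` in `N·M_{2g}(ℤ)` for some `k` — the
  `δ`-typed `ℓ`-adic CONGRUENCE points of level `N` (`A_P ∈ GL_{2g}(ℤ[1/ℓ])`, `A_P ≡ 1 mod N`) — form a subgroup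
  (`toSpForm` is a homomorphism ★);
* it contains `n(b)` whenever `ℓᵏ Δ⁻¹ b ∈ N·M_g(ℤ)` (`M_{n(b)} = (1 0; Δ⁻¹b 1)`, `A_{n(b)} = (1 0; -Δ⁻¹b 1)`) and `v(c)`
  whenever `ℓᵏ c ∈ N·M_g(ℤ)` (`M_{v(c)} = (1 cΔ; 0 1)`, `A_{v(c)} = (1 -cΔ; 0 1)`);
* symmetric matrices of both kinds are dense in `Sym_g(ℝ)` (approximants `D ⌊ℓⁿ b/D⌋ / ℓⁿ`, `D = N·∏ δᵢ`), so the
  closure contains both unipotent radicals, hence is `Sp_{2g}(ℝ)` (★ `eq_top_of_unip_low_mem`, [Artin1988] V Thm. 5.1):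
  **`dense_setOf_ellAdic_toSpForm`**;
* hence the `δ`-typed `ℓ`-POWER HECKE ORBIT of every `Z ∈ 𝔥_g` is dense: **`dense_setOf_exists_ellAdic_toSpForm_smul_eq`**,
  `exists_ellAdic_toSpForm_smul_mem`.

Cell hodgecm-mathlib (D-0151), E-road «EQUIDIM by proof», Hecke-link line card v1.1, (A3) := ℓ-adic choice (B-plan1 (g14)
2026-08-29T19:38:16Z (2)); consumer: B3+ `exists_ellAdicMove_integral` (`γ ∈ GSp_δ(ℚ)` integral, `≡ 1 mod N`, `ℓᴷ γ⁻¹` integral — B-p14 (g14)'s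
`QuotientAdapted` QA1–QA4).
Count-neutral capital: HC_CM is proved only modulo the 7 printed citations until rung 0 closes; this file discharges none.

## References
* [PlatonovRapinchuk1994] V. Platonov, A. Rapinchuk, *Algebraic Groups and Number Theory* (1994), §7.4 Thm. 7.12.
* [Lange2023AbelianVarietiesComplex] H. Lange, *Abelian Varieties over the Complex Numbers* (2023), §3.1.4 Rem. 3.1.14,
  §7.1.2 Lemma 7.1.7.
* [Artin1988] E. Artin, *Geometric Algebra*, Chap. V Thm. 5.1.
* [MoonenOort2013Torelli] B. Moonen, F. Oort (2013), §3 (b).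
-/

set_option autoImplicit false

noncomputable section

open Matrix Function Set Filter
open scoped Topology

namespace Literature.AlgebraicGeometry.ModuliOfAbelianVarieties

namespace SiegelModuli

open Literature.NumberTheory.Automorphic (siegelUpperHalfSpace)
open Literature.NumberTheory.ModularForms.SiegelUpperHalfSpace
open Literature.RepresentationTheory.HeisenbergGroup.SymplecticMatrix (unip low coe_unip coe_low unip_neg)
open Literature.LinearAlgebra.Matrix.SymplecticMatrix (eq_top_of_unip_low_mem)

variable {g : ℕ} {δ : Fin g → ℕ} (ℓ : ℕ)

/-! ## §1 The rational representations of the unipotent generators -/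

/-- `v(-c) = v(c)⁻¹`. [folklore] -/
private theorem low_neg' (c : Matrix (Fin g) (Fin g) ℝ) (hc : c.IsSymm) :
    (low (-c) hc.neg : Matrix.symplecticGroup (Fin g) ℝ) = (low c hc)⁻¹ := by
  rw [eq_inv_iff_mul_eq_one]
  apply Subtype.ext
  simp only [coe_low, Submonoid.coe_mul, OneMemClass.coe_one, fromBlocks_multiply, Matrix.mul_zero, Matrix.zero_mul,
    Matrix.one_mul, Matrix.mul_one, add_zero, zero_add, neg_add_cancel, fromBlocks_one]

/-- **`M_{n(b)} = diag(1,Δ)⁻¹ ᵗn(b) diag(1,Δ) = (1 0; Δ⁻¹ b 1)`.** [cite: Lange2023AbelianVarietiesComplex, §3.1.4 Remark 3.1.14] -/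
theorem ratRep_unip (hδ : ∀ i, 0 < δ i) (b : Matrix (Fin g) (Fin g) ℝ) (hb : b.IsSymm) :
    ratRep δ ((unip b hb : Matrix.symplecticGroup (Fin g) ℝ) : Matrix (Fin g ⊕ Fin g) (Fin g ⊕ Fin g) ℝ) =
      fromBlocks 1 0 ((diagonal fun i ↦ ((δ i : ℝ))⁻¹) * b) 1 := by
  rw [ratRep, coe_unip, fromBlocks_transpose, transpose_one, transpose_zero, hb.eq, typeDiagInv,
    typeDiag, fromBlocks_multiply, fromBlocks_multiply]
  have hD : (diagonal fun i ↦ ((δ i : ℝ))⁻¹) * diagonal (fun i ↦ (δ i : ℝ)) = 1 := by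
    rw [diagonal_mul_diagonal, ← diagonal_one]
    congr 1; funext i; exact inv_mul_cancel₀ (Nat.cast_ne_zero.2 (hδ i).ne')
  simp only [Matrix.mul_one, Matrix.mul_zero, Matrix.zero_mul, add_zero, zero_add, hD]

/-- **`M_{v(c)} = diag(1,Δ)⁻¹ ᵗv(c) diag(1,Δ) = (1 cΔ; 0 1)`.** [cite: Lange2023AbelianVarietiesComplex, §3.1.4 Remark 3.1.14] -/
theorem ratRep_low (hδ : ∀ i, 0 < δ i) (c : Matrix (Fin g) (Fin g) ℝ) (hc : c.IsSymm) :
    ratRep δ ((low c hc : Matrix.symplecticGroup (Fin g) ℝ) : Matrix (Fin g ⊕ Fin g) (Fin g ⊕ Fin g) ℝ) =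
      fromBlocks 1 (c * diagonal fun i ↦ (δ i : ℝ)) 0 1 := by
  rw [ratRep, coe_low, fromBlocks_transpose, transpose_one, transpose_zero, hc.eq, typeDiagInv,
    typeDiag, fromBlocks_multiply, fromBlocks_multiply]
  have hD : (diagonal fun i ↦ ((δ i : ℝ))⁻¹) * diagonal (fun i ↦ (δ i : ℝ)) = 1 := by
    rw [diagonal_mul_diagonal, ← diagonal_one]
    congr 1; funext i; exact inv_mul_cancel₀ (Nat.cast_ne_zero.2 (hδ i).ne')
  simp only [Matrix.mul_one, Matrix.one_mul, Matrix.mul_zero, Matrix.zero_mul, add_zero, zero_add, hD]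

/-- `M_{n(b)}` as the inverse matrix of `A_{n(b)}` and `A_{n(b)} = M_{n(-b)}`: the matrix of `toSpForm hδ (n b)` is
`(1 0; -Δ⁻¹b 1)` and of its inverse `(1 0; Δ⁻¹b 1)`. [cite: Lange2023AbelianVarietiesComplex, §7.1.2 Lemma 7.1.7] -/
theorem coe_toSpForm_unip (hδ : ∀ i, 0 < δ i) (b : Matrix (Fin g) (Fin g) ℝ) (hb : b.IsSymm) :
    ((toSpForm hδ (unip b hb) : GL (Fin g ⊕ Fin g) ℝ) : Matrix (Fin g ⊕ Fin g) (Fin g ⊕ Fin g) ℝ) = fromBlocks 1 0 ((diagonal fun i ↦ ((δ i : ℝ))⁻¹) * (-b)) 1 ∧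
    (((toSpForm hδ (unip b hb) : GL (Fin g ⊕ Fin g) ℝ)⁻¹ : GL (Fin g ⊕ Fin g) ℝ) : Matrix (Fin g ⊕ Fin g) (Fin g ⊕ Fin g) ℝ) =
      fromBlocks 1 0 ((diagonal fun i ↦ ((δ i : ℝ))⁻¹) * b) 1 := by
  refine ⟨?_, ?_⟩
  · change ((unitOfSymplectic hδ (unip b hb) : GL (Fin g ⊕ Fin g) ℝ) : Matrix (Fin g ⊕ Fin g) (Fin g ⊕ Fin g) ℝ) = _
    rw [coe_unitOfSymplectic, ← unip_neg]
    have h := ratRep_unip hδ (-b) hb.neg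
    rwa [ratRep] at h
  · rw [coe_toSpForm_inv]
    exact ratRep_unip hδ b hb

/-- The matrix of `toSpForm hδ (v c)` is `(1 -cΔ; 0 1)` and of its inverse `(1 cΔ; 0 1)`.
[cite: Lange2023AbelianVarietiesComplex, §7.1.2 Lemma 7.1.7] -/
theorem coe_toSpForm_low (hδ : ∀ i, 0 < δ i) (c : Matrix (Fin g) (Fin g) ℝ) (hc : c.IsSymm) :
    ((toSpForm hδ (low c hc) : GL (Fin g ⊕ Fin g) ℝ) : Matrix (Fin g ⊕ Fin g) (Fin g ⊕ Fin g) ℝ) = fromBlocks 1 ((-c) * diagonal fun i ↦ (δ i : ℝ)) 0 1 ∧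
    (((toSpForm hδ (low c hc) : GL (Fin g ⊕ Fin g) ℝ)⁻¹ : GL (Fin g ⊕ Fin g) ℝ) : Matrix (Fin g ⊕ Fin g) (Fin g ⊕ Fin g) ℝ) =
      fromBlocks 1 (c * diagonal fun i ↦ (δ i : ℝ)) 0 1 := by
  refine ⟨?_, ?_⟩
  · change ((unitOfSymplectic hδ (low c hc) : GL (Fin g ⊕ Fin g) ℝ) : Matrix (Fin g ⊕ Fin g) (Fin g ⊕ Fin g) ℝ) = _
    rw [coe_unitOfSymplectic, ← low_neg']
    have h := ratRep_low hδ (-c) hc.neg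
    rwa [ratRep] at h
  · rw [coe_toSpForm_inv]
    exact ratRep_low hδ c hc

/-! ## §2 The `δ`-typed `ℓ`-adic congruence points of level `N` form a subgroup -/

/-- **Congruence products, entrywise.** If `a(A − 1)` and `b(B − 1)` have entries in `N·ℤ` with `a, b ∈ ℕ`, then so does
`ab(AB − 1) = [a(A−1)][b(B−1)] + b[a(A−1)] + a[b(B−1)]`. [folklore] -/
private theorem exists_congr_mul {A B : Matrix (Fin g ⊕ Fin g) (Fin g ⊕ Fin g) ℝ} {a b N : ℕ}
    (hA : ∀ i j, ∃ z : ℤ, (a : ℝ) * (A i j - (1 : Matrix (Fin g ⊕ Fin g) (Fin g ⊕ Fin g) ℝ) i j) = N * z)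
    (hB : ∀ i j, ∃ z : ℤ, (b : ℝ) * (B i j - (1 : Matrix (Fin g ⊕ Fin g) (Fin g ⊕ Fin g) ℝ) i j) = N * z) (i j : Fin g ⊕ Fin g) :
    ∃ z : ℤ, ((a : ℝ) * b) * ((A * B) i j - (1 : Matrix (Fin g ⊕ Fin g) (Fin g ⊕ Fin g) ℝ) i j) = N * z := by
  classical
  choose zA hzA using hA
  choose zB hzB using hB
  set X : Matrix (Fin g ⊕ Fin g) (Fin g ⊕ Fin g) ℝ := (a : ℝ) • (A - 1) with hX
  set Y : Matrix (Fin g ⊕ Fin g) (Fin g ⊕ Fin g) ℝ := (b : ℝ) • (B - 1) with hY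
  have key : ((a : ℝ) * b) • (A * B - 1) = X * Y + (b : ℝ) • X + (a : ℝ) • Y := by
    simp only [hX, hY, Matrix.smul_mul, Matrix.mul_smul, smul_smul, Matrix.sub_mul, Matrix.mul_sub, Matrix.one_mul,
      Matrix.mul_one, smul_sub, mul_comm (b : ℝ) (a : ℝ)]
    abel
  have hXe : ∀ p q, X p q = N * zA p q := fun p q ↦ by
    rw [hX, Matrix.smul_apply, smul_eq_mul, Matrix.sub_apply]; exact hzA p q
  have hYe : ∀ p q, Y p q = N * zB p q := fun p q ↦ by
    rw [hY, Matrix.smul_apply, smul_eq_mul, Matrix.sub_apply]; exact hzB p q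
  refine ⟨∑ k, (N : ℤ) * (zA i k * zB k j) + b * zA i j + a * zB i j, ?_⟩
  have h := congr_fun (congr_fun key i) j
  rw [Matrix.smul_apply, smul_eq_mul, Matrix.sub_apply] at h
  rw [h, Matrix.add_apply, Matrix.add_apply, Matrix.smul_apply, Matrix.smul_apply, smul_eq_mul, smul_eq_mul,
    Matrix.mul_apply, hXe, hYe]
  simp_rw [hXe, hYe]
  push_cast
  have hsum : ∑ x, (N : ℝ) * (zA i x : ℝ) * ((N : ℝ) * (zB x j : ℝ)) =
      (N : ℝ) * ∑ x, (N : ℝ) * ((zA i x : ℝ) * (zB x j : ℝ)) := by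
    rw [Finset.mul_sum]
    exact Finset.sum_congr rfl fun k _ ↦ by ring
  rw [hsum]
  ring

variable (N : ℕ)

/-- Closure under products of the `δ`-typed `ℓ`-adic congruence points (`A_{PQ} = A_P A_Q`, `M_{PQ} = M_Q M_P`).
[cite: Lange2023AbelianVarietiesComplex, §7.1.2 Lemma 7.1.7] -/
theorem ellAdicCongr_toSpForm_mul (hδ : ∀ i, 0 < δ i) {P Q : Matrix.symplecticGroup (Fin g) ℝ}
    (hP : ∃ k : ℕ, (∀ i j, ∃ z : ℤ, (ℓ : ℝ) ^ k * (((toSpForm hδ P : GL (Fin g ⊕ Fin g) ℝ) : Matrix (Fin g ⊕ Fin g) (Fin g ⊕ Fin g) ℝ) i j - (1 : Matrix (Fin g ⊕ Fin g) (Fin g ⊕ Fin g) ℝ) i j) = N * z) ∧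
      (∀ i j, ∃ z : ℤ, (ℓ : ℝ) ^ k * ((((toSpForm hδ P : GL (Fin g ⊕ Fin g) ℝ)⁻¹ : GL (Fin g ⊕ Fin g) ℝ) : Matrix (Fin g ⊕ Fin g) (Fin g ⊕ Fin g) ℝ) i j - (1 : Matrix (Fin g ⊕ Fin g) (Fin g ⊕ Fin g) ℝ) i j) = N * z))
    (hQ : ∃ k : ℕ, (∀ i j, ∃ z : ℤ, (ℓ : ℝ) ^ k * (((toSpForm hδ Q : GL (Fin g ⊕ Fin g) ℝ) : Matrix (Fin g ⊕ Fin g) (Fin g ⊕ Fin g) ℝ) i j - (1 : Matrix (Fin g ⊕ Fin g) (Fin g ⊕ Fin g) ℝ) i j) = N * z) ∧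
      (∀ i j, ∃ z : ℤ, (ℓ : ℝ) ^ k * ((((toSpForm hδ Q : GL (Fin g ⊕ Fin g) ℝ)⁻¹ : GL (Fin g ⊕ Fin g) ℝ) : Matrix (Fin g ⊕ Fin g) (Fin g ⊕ Fin g) ℝ) i j - (1 : Matrix (Fin g ⊕ Fin g) (Fin g ⊕ Fin g) ℝ) i j) = N * z)) :
    ∃ k : ℕ, (∀ i j, ∃ z : ℤ, (ℓ : ℝ) ^ k * (((toSpForm hδ (P * Q) : GL (Fin g ⊕ Fin g) ℝ) : Matrix (Fin g ⊕ Fin g) (Fin g ⊕ Fin g) ℝ) i j - (1 : Matrix (Fin g ⊕ Fin g) (Fin g ⊕ Fin g) ℝ) i j) = N * z) ∧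
      (∀ i j, ∃ z : ℤ, (ℓ : ℝ) ^ k * ((((toSpForm hδ (P * Q) : GL (Fin g ⊕ Fin g) ℝ)⁻¹ : GL (Fin g ⊕ Fin g) ℝ) : Matrix (Fin g ⊕ Fin g) (Fin g ⊕ Fin g) ℝ) i j - (1 : Matrix (Fin g ⊕ Fin g) (Fin g ⊕ Fin g) ℝ) i j) = N * z) := by
  obtain ⟨k, hk, hk'⟩ := hP
  obtain ⟨k', hl, hl'⟩ := hQ
  refine ⟨k + k', fun i j ↦ ?_, fun i j ↦ ?_⟩
  · rw [map_mul, Subgroup.coe_mul, Units.val_mul, pow_add, ← Nat.cast_pow, ← Nat.cast_pow]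
    exact exists_congr_mul (by simpa only [Nat.cast_pow] using hk) (by simpa only [Nat.cast_pow] using hl) i j
  · rw [map_mul, Subgroup.coe_mul, _root_.mul_inv_rev, Units.val_mul, pow_add, mul_comm ((ℓ : ℝ) ^ k),
      ← Nat.cast_pow, ← Nat.cast_pow]
    exact exists_congr_mul (by simpa only [Nat.cast_pow] using hl') (by simpa only [Nat.cast_pow] using hk') i j

/-- `1` is a `δ`-typed `ℓ`-adic congruence point. [cite: Lange2023AbelianVarietiesComplex, §7.1.2 Lemma 7.1.7] -/
theorem ellAdicCongr_toSpForm_one (hδ : ∀ i, 0 < δ i) :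
    ∃ k : ℕ, (∀ i j, ∃ z : ℤ, (ℓ : ℝ) ^ k * (((toSpForm hδ 1 : GL (Fin g ⊕ Fin g) ℝ) : Matrix (Fin g ⊕ Fin g) (Fin g ⊕ Fin g) ℝ) i j - (1 : Matrix (Fin g ⊕ Fin g) (Fin g ⊕ Fin g) ℝ) i j) = N * z) ∧
      (∀ i j, ∃ z : ℤ, (ℓ : ℝ) ^ k * ((((toSpForm hδ 1 : GL (Fin g ⊕ Fin g) ℝ)⁻¹ : GL (Fin g ⊕ Fin g) ℝ) : Matrix (Fin g ⊕ Fin g) (Fin g ⊕ Fin g) ℝ) i j - (1 : Matrix (Fin g ⊕ Fin g) (Fin g ⊕ Fin g) ℝ) i j) = N * z) := by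
  refine ⟨0, fun i j ↦ ⟨0, ?_⟩, fun i j ↦ ⟨0, ?_⟩⟩
  · rw [map_one, Subgroup.coe_one, Units.val_one, sub_self, mul_zero, Int.cast_zero, mul_zero]
  · rw [map_one, Subgroup.coe_one, inv_one, Units.val_one, sub_self, mul_zero, Int.cast_zero, mul_zero]

/-- Inverses of `δ`-typed `ℓ`-adic congruence points (the two clauses swap).
[cite: Lange2023AbelianVarietiesComplex, §7.1.2 Lemma 7.1.7] -/
theorem ellAdicCongr_toSpForm_inv (hδ : ∀ i, 0 < δ i) {P : Matrix.symplecticGroup (Fin g) ℝ}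
    (hP : ∃ k : ℕ, (∀ i j, ∃ z : ℤ, (ℓ : ℝ) ^ k * (((toSpForm hδ P : GL (Fin g ⊕ Fin g) ℝ) : Matrix (Fin g ⊕ Fin g) (Fin g ⊕ Fin g) ℝ) i j - (1 : Matrix (Fin g ⊕ Fin g) (Fin g ⊕ Fin g) ℝ) i j) = N * z) ∧
      (∀ i j, ∃ z : ℤ, (ℓ : ℝ) ^ k * ((((toSpForm hδ P : GL (Fin g ⊕ Fin g) ℝ)⁻¹ : GL (Fin g ⊕ Fin g) ℝ) : Matrix (Fin g ⊕ Fin g) (Fin g ⊕ Fin g) ℝ) i j - (1 : Matrix (Fin g ⊕ Fin g) (Fin g ⊕ Fin g) ℝ) i j) = N * z)) :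
    ∃ k : ℕ, (∀ i j, ∃ z : ℤ, (ℓ : ℝ) ^ k * (((toSpForm hδ P⁻¹ : GL (Fin g ⊕ Fin g) ℝ) : Matrix (Fin g ⊕ Fin g) (Fin g ⊕ Fin g) ℝ) i j - (1 : Matrix (Fin g ⊕ Fin g) (Fin g ⊕ Fin g) ℝ) i j) = N * z) ∧
      (∀ i j, ∃ z : ℤ, (ℓ : ℝ) ^ k * ((((toSpForm hδ P⁻¹ : GL (Fin g ⊕ Fin g) ℝ)⁻¹ : GL (Fin g ⊕ Fin g) ℝ) : Matrix (Fin g ⊕ Fin g) (Fin g ⊕ Fin g) ℝ) i j - (1 : Matrix (Fin g ⊕ Fin g) (Fin g ⊕ Fin g) ℝ) i j) = N * z) := by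
  obtain ⟨k, hk, hk'⟩ := hP
  refine ⟨k, fun i j ↦ ?_, fun i j ↦ ?_⟩
  · rw [map_inv, Subgroup.coe_inv]
    exact hk' i j
  · rw [map_inv, Subgroup.coe_inv, inv_inv]
    exact hk i j

omit N in
/-- Entrywise congruence criterion for the block matrices `(1 0; X 1) − 1` and `(1 X; 0 1) − 1`: if `n·X ∈ N·M(ℤ)` then
`n·((1 0; X 1) − 1)`, `n·((1 X; 0 1) − 1) ∈ N·M(ℤ)`. [folklore] -/
private theorem exists_congr_fromBlocks {X : Matrix (Fin g) (Fin g) ℝ} {n N : ℕ}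
    (hX : ∀ i j, ∃ z : ℤ, (n : ℝ) * X i j = N * z) (i j : Fin g ⊕ Fin g) :
    (∃ z : ℤ, (n : ℝ) * ((fromBlocks 1 0 X 1 : Matrix (Fin g ⊕ Fin g) (Fin g ⊕ Fin g) ℝ) i j - (1 : Matrix (Fin g ⊕ Fin g) (Fin g ⊕ Fin g) ℝ) i j) = N * z) ∧
    (∃ z : ℤ, (n : ℝ) * ((fromBlocks 1 X 0 1 : Matrix (Fin g ⊕ Fin g) (Fin g ⊕ Fin g) ℝ) i j - (1 : Matrix (Fin g ⊕ Fin g) (Fin g ⊕ Fin g) ℝ) i j) = N * z) := by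
  rw [← fromBlocks_one]
  rcases i with i | i <;> rcases j with j | j
  · refine ⟨⟨0, ?_⟩, ⟨0, ?_⟩⟩ <;>
    · rw [fromBlocks_apply₁₁, fromBlocks_apply₁₁, sub_self, mul_zero, Int.cast_zero, mul_zero]
  · refine ⟨⟨0, ?_⟩, ?_⟩
    · rw [fromBlocks_apply₁₂, fromBlocks_apply₁₂, sub_self, mul_zero, Int.cast_zero, mul_zero]
    · rw [fromBlocks_apply₁₂, fromBlocks_apply₁₂, Matrix.zero_apply, sub_zero]; exact hX i j
  · refine ⟨?_, ⟨0, ?_⟩⟩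
    · rw [fromBlocks_apply₂₁, fromBlocks_apply₂₁, Matrix.zero_apply, sub_zero]; exact hX i j
    · rw [fromBlocks_apply₂₁, fromBlocks_apply₂₁, sub_self, mul_zero, Int.cast_zero, mul_zero]
  · refine ⟨⟨0, ?_⟩, ⟨0, ?_⟩⟩ <;>
    · rw [fromBlocks_apply₂₂, fromBlocks_apply₂₂, sub_self, mul_zero, Int.cast_zero, mul_zero]

/-- **`n(b)` is a congruence point when `ℓᵏ Δ⁻¹ b ∈ N·M_g(ℤ)`.** [cite: Lange2023AbelianVarietiesComplex, §7.1.2 Lemma 7.1.7] -/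
theorem ellAdicCongr_toSpForm_unip (hδ : ∀ i, 0 < δ i) {b : Matrix (Fin g) (Fin g) ℝ} (hb : b.IsSymm) {k : ℕ}
    (hbk : ∀ i j, ∃ z : ℤ, (ℓ : ℝ) ^ k * (((δ i : ℝ))⁻¹ * b i j) = N * z) :
    ∃ k : ℕ, (∀ i j, ∃ z : ℤ, (ℓ : ℝ) ^ k * (((toSpForm hδ (unip b hb) : GL (Fin g ⊕ Fin g) ℝ) : Matrix (Fin g ⊕ Fin g) (Fin g ⊕ Fin g) ℝ) i j - (1 : Matrix (Fin g ⊕ Fin g) (Fin g ⊕ Fin g) ℝ) i j) = N * z) ∧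
      (∀ i j, ∃ z : ℤ, (ℓ : ℝ) ^ k * ((((toSpForm hδ (unip b hb) : GL (Fin g ⊕ Fin g) ℝ)⁻¹ : GL (Fin g ⊕ Fin g) ℝ) : Matrix (Fin g ⊕ Fin g) (Fin g ⊕ Fin g) ℝ) i j - (1 : Matrix (Fin g ⊕ Fin g) (Fin g ⊕ Fin g) ℝ) i j) = N * z) := by
  obtain ⟨h1, h2⟩ := coe_toSpForm_unip hδ b hb
  have hX : ∀ i j, ∃ z : ℤ, ((ℓ ^ k : ℕ) : ℝ) * ((diagonal fun i ↦ ((δ i : ℝ))⁻¹) * b) i j = N * z := fun i j ↦ by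
    rw [diagonal_mul, Nat.cast_pow]; exact hbk i j
  have hX' : ∀ i j, ∃ z : ℤ, ((ℓ ^ k : ℕ) : ℝ) * ((diagonal fun i ↦ ((δ i : ℝ))⁻¹) * (-b)) i j = N * z := fun i j ↦ by
    obtain ⟨z, hz⟩ := hX i j
    refine ⟨-z, ?_⟩
    rw [Matrix.mul_neg, Matrix.neg_apply, mul_neg, hz, Int.cast_neg, mul_neg]
  refine ⟨k, fun i j ↦ ?_, fun i j ↦ ?_⟩
  · rw [h1, ← Nat.cast_pow]; exact (exists_congr_fromBlocks hX' i j).1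
  · rw [h2, ← Nat.cast_pow]; exact (exists_congr_fromBlocks hX i j).1

/-- **`v(c)` is a congruence point when `ℓᵏ c ∈ N·M_g(ℤ)`** (then so is `ℓᵏ c Δ`).
[cite: Lange2023AbelianVarietiesComplex, §7.1.2 Lemma 7.1.7] -/
theorem ellAdicCongr_toSpForm_low (hδ : ∀ i, 0 < δ i) {c : Matrix (Fin g) (Fin g) ℝ} (hc : c.IsSymm) {k : ℕ}
    (hck : ∀ i j, ∃ z : ℤ, (ℓ : ℝ) ^ k * c i j = N * z) :
    ∃ k : ℕ, (∀ i j, ∃ z : ℤ, (ℓ : ℝ) ^ k * (((toSpForm hδ (low c hc) : GL (Fin g ⊕ Fin g) ℝ) : Matrix (Fin g ⊕ Fin g) (Fin g ⊕ Fin g) ℝ) i j - (1 : Matrix (Fin g ⊕ Fin g) (Fin g ⊕ Fin g) ℝ) i j) = N * z) ∧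
      (∀ i j, ∃ z : ℤ, (ℓ : ℝ) ^ k * ((((toSpForm hδ (low c hc) : GL (Fin g ⊕ Fin g) ℝ)⁻¹ : GL (Fin g ⊕ Fin g) ℝ) : Matrix (Fin g ⊕ Fin g) (Fin g ⊕ Fin g) ℝ) i j - (1 : Matrix (Fin g ⊕ Fin g) (Fin g ⊕ Fin g) ℝ) i j) = N * z) := by
  obtain ⟨h1, h2⟩ := coe_toSpForm_low hδ c hc
  have hX : ∀ i j, ∃ z : ℤ, ((ℓ ^ k : ℕ) : ℝ) * (c * diagonal fun i ↦ (δ i : ℝ)) i j = N * z := fun i j ↦ by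
    obtain ⟨z, hz⟩ := hck i j
    refine ⟨z * δ j, ?_⟩
    rw [mul_diagonal, Nat.cast_pow, ← mul_assoc, hz, Int.cast_mul, Int.cast_natCast, mul_assoc]
  have hX' : ∀ i j, ∃ z : ℤ, ((ℓ ^ k : ℕ) : ℝ) * ((-c) * diagonal fun i ↦ (δ i : ℝ)) i j = N * z := fun i j ↦ by
    obtain ⟨z, hz⟩ := hX i j
    refine ⟨-z, ?_⟩
    rw [Matrix.neg_mul, Matrix.neg_apply, mul_neg, hz, Int.cast_neg, mul_neg]
  refine ⟨k, fun i j ↦ ?_, fun i j ↦ ?_⟩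
  · rw [h1, ← Nat.cast_pow]; exact (exists_congr_fromBlocks hX' i j).2
  · rw [h2, ← Nat.cast_pow]; exact (exists_congr_fromBlocks hX i j).2

/-! ## §3 Approximation and density -/

omit ℓ N in
/-- **Symmetric matrices with entries in `D·ℓ⁻ⁿℤ` approximate every real symmetric matrix**: `b⁽ⁿ⁾ := D ⌊ℓⁿ b / D⌋ / ℓⁿ`
is symmetric, `ℓⁿ b⁽ⁿ⁾ ∈ D·M(ℤ)`, and `b⁽ⁿ⁾ → b`. [cite: PlatonovRapinchuk1994, §7.4 Thm. 7.12] -/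
theorem exists_seq_isSymm_mul_ellAdic_tendsto {ℓ : ℕ} (hℓ : 2 ≤ ℓ) {D : ℕ} (hD : 0 < D)
    {b : Matrix (Fin g) (Fin g) ℝ} (hb : b.IsSymm) :
    ∃ W : ℕ → Matrix (Fin g) (Fin g) ℝ, (∀ n, (W n).IsSymm) ∧
      (∀ n i j, ∃ z : ℤ, (ℓ : ℝ) ^ n * W n i j = D * z) ∧ Tendsto W atTop (𝓝 b) := by
  have hℓpos : (0 : ℝ) < ℓ := by exact_mod_cast (by omega : 0 < ℓ)
  have hℓne : ∀ n : ℕ, ((ℓ : ℝ) ^ n) ≠ 0 := fun n ↦ pow_ne_zero n hℓpos.ne'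
  have hDpos : (0 : ℝ) < D := by exact_mod_cast hD
  refine ⟨fun n ↦ Matrix.of fun i j ↦ (D : ℝ) * (⌊(ℓ : ℝ) ^ n * b i j / D⌋ : ℝ) / (ℓ : ℝ) ^ n,
    fun n ↦ ?_, fun n i j ↦ ?_, ?_⟩
  · refine Matrix.IsSymm.ext fun i j ↦ ?_
    simp only [Matrix.of_apply, hb.apply i j]
  · refine ⟨⌊(ℓ : ℝ) ^ n * b i j / D⌋, ?_⟩
    show (ℓ : ℝ) ^ n * ((D : ℝ) * (⌊(ℓ : ℝ) ^ n * b i j / D⌋ : ℝ) / (ℓ : ℝ) ^ n) = _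
    rw [mul_div_cancel₀ _ (hℓne n)]
  · refine tendsto_pi_nhds.2 fun i ↦ tendsto_pi_nhds.2 fun j ↦ ?_
    simp only [Matrix.of_apply]
    have hupper : ∀ n : ℕ, (D : ℝ) * (⌊(ℓ : ℝ) ^ n * b i j / D⌋ : ℝ) / (ℓ : ℝ) ^ n ≤ b i j := fun n ↦ by
      rw [div_le_iff₀ (pow_pos hℓpos n)]
      have h' : (D : ℝ) * (⌊(ℓ : ℝ) ^ n * b i j / D⌋ : ℝ) ≤ (D : ℝ) * ((ℓ : ℝ) ^ n * b i j / D) :=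
        mul_le_mul_of_nonneg_left (Int.floor_le _) hDpos.le
      rw [mul_div_cancel₀ _ hDpos.ne'] at h'
      linarith
    have hlower : ∀ n : ℕ, b i j - (D : ℝ) * (1 / (ℓ : ℝ)) ^ n ≤
        (D : ℝ) * (⌊(ℓ : ℝ) ^ n * b i j / D⌋ : ℝ) / (ℓ : ℝ) ^ n := fun n ↦ by
      rw [le_div_iff₀ (pow_pos hℓpos n), sub_mul, one_div, inv_pow, mul_assoc, inv_mul_cancel₀ (hℓne n), mul_one]
      have h' : (D : ℝ) * ((ℓ : ℝ) ^ n * b i j / D) < (D : ℝ) * ((⌊(ℓ : ℝ) ^ n * b i j / D⌋ : ℝ) + 1) :=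
        mul_lt_mul_of_pos_left (Int.lt_floor_add_one _) hDpos
      rw [mul_div_cancel₀ _ hDpos.ne', mul_add, mul_one] at h'
      linarith
    have hlim : Tendsto (fun n : ℕ ↦ b i j - (D : ℝ) * (1 / (ℓ : ℝ)) ^ n) atTop (𝓝 (b i j)) := by
      have h1 : Tendsto (fun n : ℕ ↦ (1 / (ℓ : ℝ)) ^ n) atTop (𝓝 0) := by
        refine tendsto_pow_atTop_nhds_zero_of_lt_one (by positivity) ?_
        rw [div_lt_one hℓpos]
        exact_mod_cast (by omega : 1 < ℓ)
      have h2 : Tendsto (fun n : ℕ ↦ (D : ℝ) * (1 / (ℓ : ℝ)) ^ n) atTop (𝓝 0) := by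
        simpa using h1.const_mul (D : ℝ)
      simpa using (tendsto_const_nhds (x := b i j)).sub h2
    exact tendsto_of_tendsto_of_tendsto_of_le_of_le hlim tendsto_const_nhds hlower hupper

/-- **THE `δ`-TYPED `ℓ`-ADIC CONGRUENCE POINTS OF LEVEL `N` ARE DENSE IN `Sp_{2g}(ℝ)`** (`ℓ ≥ 2`, `N ≥ 1`, `δᵢ ≥ 1`): they form
a subgroup whose closure contains `n(Sym_g ℝ)` and `v(Sym_g ℝ)`, hence is everything (★ `eq_top_of_unip_low_mem`).
[cite: PlatonovRapinchuk1994, §7.4 Thm. 7.12] [cite: Artin1988, Chap. V Thm. 5.1] [cite: Lange2023AbelianVarietiesComplex, §7.1.2 Lemma 7.1.7] -/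
theorem dense_setOf_ellAdicCongr_toSpForm (hℓ : 2 ≤ ℓ) (hN : 0 < N) (hδ : ∀ i, 0 < δ i) :
    Dense {P : Matrix.symplecticGroup (Fin g) ℝ | ∃ k : ℕ, (∀ i j, ∃ z : ℤ, (ℓ : ℝ) ^ k * (((toSpForm hδ P : GL (Fin g ⊕ Fin g) ℝ) : Matrix (Fin g ⊕ Fin g) (Fin g ⊕ Fin g) ℝ) i j - (1 : Matrix (Fin g ⊕ Fin g) (Fin g ⊕ Fin g) ℝ) i j) = N * z) ∧
      (∀ i j, ∃ z : ℤ, (ℓ : ℝ) ^ k * ((((toSpForm hδ P : GL (Fin g ⊕ Fin g) ℝ)⁻¹ : GL (Fin g ⊕ Fin g) ℝ) : Matrix (Fin g ⊕ Fin g) (Fin g ⊕ Fin g) ℝ) i j - (1 : Matrix (Fin g ⊕ Fin g) (Fin g ⊕ Fin g) ℝ) i j) = N * z)} := by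
  let H : Subgroup (Matrix.symplecticGroup (Fin g) ℝ) :=
    { carrier := {P | ∃ k : ℕ, (∀ i j, ∃ z : ℤ, (ℓ : ℝ) ^ k * (((toSpForm hδ P : GL (Fin g ⊕ Fin g) ℝ) : Matrix (Fin g ⊕ Fin g) (Fin g ⊕ Fin g) ℝ) i j - (1 : Matrix (Fin g ⊕ Fin g) (Fin g ⊕ Fin g) ℝ) i j) = N * z) ∧
      (∀ i j, ∃ z : ℤ, (ℓ : ℝ) ^ k * ((((toSpForm hδ P : GL (Fin g ⊕ Fin g) ℝ)⁻¹ : GL (Fin g ⊕ Fin g) ℝ) : Matrix (Fin g ⊕ Fin g) (Fin g ⊕ Fin g) ℝ) i j - (1 : Matrix (Fin g ⊕ Fin g) (Fin g ⊕ Fin g) ℝ) i j) = N * z)}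
      mul_mem' := fun {P Q} hP hQ ↦ ellAdicCongr_toSpForm_mul ℓ N hδ hP hQ
      one_mem' := ellAdicCongr_toSpForm_one ℓ N hδ
      inv_mem' := fun {P} hP ↦ ellAdicCongr_toSpForm_inv ℓ N hδ hP }
  have hDpos : 0 < N * ∏ i, δ i := Nat.mul_pos hN (Finset.prod_pos fun i _ ↦ hδ i)
  have hn : ∀ (b : Matrix (Fin g) (Fin g) ℝ) (hb : b.IsSymm), unip b hb ∈ H.topologicalClosure := by
    intro b hb
    obtain ⟨W, hWs, hWz, hWt⟩ := exists_seq_isSymm_mul_ellAdic_tendsto hℓ hDpos hb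
    have hmem : ∀ n, unip (W n) (hWs n) ∈ (H : Set (Matrix.symplecticGroup (Fin g) ℝ)) := fun n ↦ by
      refine ellAdicCongr_toSpForm_unip ℓ N hδ (hWs n) (k := n) fun i j ↦ ?_
      obtain ⟨z, hz⟩ := hWz n i j
      obtain ⟨q, hq⟩ : δ i ∣ ∏ i, δ i := Finset.dvd_prod_of_mem _ (Finset.mem_univ i)
      refine ⟨q * z, ?_⟩
      have hδi : (δ i : ℝ) ≠ 0 := Nat.cast_ne_zero.2 (hδ i).ne'
      rw [← mul_assoc, mul_comm ((ℓ : ℝ) ^ n), mul_assoc, hz, Nat.cast_mul, Nat.cast_prod, show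
        (∏ i, (δ i : ℝ)) = (δ i : ℝ) * q by rw [← Nat.cast_prod, hq, Nat.cast_mul]]
      field_simp
      push_cast
      ring
    have ht : Tendsto (fun n ↦ unip (W n) (hWs n)) atTop (𝓝 (unip b hb)) := by
      rw [tendsto_subtype_rng]
      simp only [coe_unip]
      exact ((continuous_const.matrix_fromBlocks continuous_id continuous_const continuous_const).tendsto b).comp hWt
    rw [← SetLike.mem_coe, Subgroup.topologicalClosure_coe]
    exact mem_closure_of_tendsto ht (Eventually.of_forall hmem)
  have hv : ∀ (c : Matrix (Fin g) (Fin g) ℝ) (hc : c.IsSymm), low c hc ∈ H.topologicalClosure := by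
    intro c hc
    obtain ⟨W, hWs, hWz, hWt⟩ := exists_seq_isSymm_mul_ellAdic_tendsto hℓ hN hc
    have hmem : ∀ n, low (W n) (hWs n) ∈ (H : Set (Matrix.symplecticGroup (Fin g) ℝ)) :=
      fun n ↦ ellAdicCongr_toSpForm_low ℓ N hδ (hWs n) (k := n) (hWz n)
    have ht : Tendsto (fun n ↦ low (W n) (hWs n)) atTop (𝓝 (low c hc)) := by
      rw [tendsto_subtype_rng]
      simp only [coe_low]
      exact ((continuous_const.matrix_fromBlocks continuous_const continuous_id continuous_const).tendsto c).comp hWt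
    rw [← SetLike.mem_coe, Subgroup.topologicalClosure_coe]
    exact mem_closure_of_tendsto ht (Eventually.of_forall hmem)
  have htop : H.topologicalClosure = ⊤ := eq_top_of_unip_low_mem hn hv
  have hdense : Dense (H : Set (Matrix.symplecticGroup (Fin g) ℝ)) := by
    rw [dense_iff_closure_eq, ← Subgroup.topologicalClosure_coe, htop]
    rfl
  exact hdense

/-- **THE `δ`-TYPED `ℓ`-POWER HECKE ORBIT OF LEVEL `N` OF EVERY POINT OF `𝔥_g` IS DENSE.** [cite: PlatonovRapinchuk1994, §7.4 Thm. 7.12]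
[cite: MoonenOort2013Torelli, §3 (b)] -/
theorem dense_setOf_exists_ellAdicCongr_toSpForm_smul_eq (hℓ : 2 ≤ ℓ) (hN : 0 < N) (hδ : ∀ i, 0 < δ i)
    (Z : siegelUpperHalfSpace g) :
    Dense {W : siegelUpperHalfSpace g | ∃ P : Matrix.symplecticGroup (Fin g) ℝ, (∃ k : ℕ, (∀ i j, ∃ z : ℤ, (ℓ : ℝ) ^ k * (((toSpForm hδ P : GL (Fin g ⊕ Fin g) ℝ) : Matrix (Fin g ⊕ Fin g) (Fin g ⊕ Fin g) ℝ) i j - (1 : Matrix (Fin g ⊕ Fin g) (Fin g ⊕ Fin g) ℝ) i j) = N * z) ∧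
      (∀ i j, ∃ z : ℤ, (ℓ : ℝ) ^ k * ((((toSpForm hδ P : GL (Fin g ⊕ Fin g) ℝ)⁻¹ : GL (Fin g ⊕ Fin g) ℝ) : Matrix (Fin g ⊕ Fin g) (Fin g ⊕ Fin g) ℝ) i j - (1 : Matrix (Fin g ⊕ Fin g) (Fin g ⊕ Fin g) ℝ) i j) = N * z)) ∧ P • Z = W} := by
  have hcont : Continuous fun P : Matrix.symplecticGroup (Fin g) ℝ ↦ P • Z := continuous_id.smul continuous_const
  have hsurj : Function.Surjective fun P : Matrix.symplecticGroup (Fin g) ℝ ↦ P • Z := fun W ↦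
    MulAction.exists_smul_eq (Matrix.symplecticGroup (Fin g) ℝ) Z W
  have hD := hsurj.denseRange.dense_image hcont (dense_setOf_ellAdicCongr_toSpForm ℓ N hℓ hN hδ)
  refine hD.mono ?_
  rintro _ ⟨P, hP, rfl⟩
  exact ⟨P, hP, rfl⟩

/-- Every non-empty open subset of `𝔥_g` contains a `δ`-typed `ℓ`-power Hecke translate of level `N` of any given `Z`.
[cite: PlatonovRapinchuk1994, §7.4 Thm. 7.12] [cite: MoonenOort2013Torelli, §3 (b)] -/
theorem exists_ellAdicCongr_toSpForm_smul_mem (hℓ : 2 ≤ ℓ) (hN : 0 < N) (hδ : ∀ i, 0 < δ i) (Z : siegelUpperHalfSpace g)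
    {V : Set (siegelUpperHalfSpace g)} (hV : IsOpen V) (hne : V.Nonempty) :
    ∃ P : Matrix.symplecticGroup (Fin g) ℝ, (∃ k : ℕ, (∀ i j, ∃ z : ℤ, (ℓ : ℝ) ^ k * (((toSpForm hδ P : GL (Fin g ⊕ Fin g) ℝ) : Matrix (Fin g ⊕ Fin g) (Fin g ⊕ Fin g) ℝ) i j - (1 : Matrix (Fin g ⊕ Fin g) (Fin g ⊕ Fin g) ℝ) i j) = N * z) ∧
      (∀ i j, ∃ z : ℤ, (ℓ : ℝ) ^ k * ((((toSpForm hδ P : GL (Fin g ⊕ Fin g) ℝ)⁻¹ : GL (Fin g ⊕ Fin g) ℝ) : Matrix (Fin g ⊕ Fin g) (Fin g ⊕ Fin g) ℝ) i j - (1 : Matrix (Fin g ⊕ Fin g) (Fin g ⊕ Fin g) ℝ) i j) = N * z)) ∧ P • Z ∈ V := by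
  obtain ⟨W, ⟨P, hP, hPW⟩, hWV⟩ := (dense_setOf_exists_ellAdicCongr_toSpForm_smul_eq ℓ N hℓ hN hδ Z).exists_mem_open hV hne
  exact ⟨P, hP, hPW ▸ hWV⟩

end SiegelModuli

end Literature.AlgebraicGeometry.ModuliOfAbelianVarieties

end
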